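import Summits.QuantumFields.BalabanUV.Beta.WardBorderWardModelClass
import Summits.QuantumFields.BalabanUV.Beta.WardBorderReflectionWallJoint
import Summits.QuantumFields.BalabanUV.Beta.WardMixedJointModel

/-!
# `BalabanUV.Beta.WardBorderJointModel` — binder row D1, (L4): **THE JOINT hR∕hW BORDER TABLE AND THE FULLY-MODELLED LITERAL WITH hR AND hW
# CLOSED, NO LETTER HYPOTHESIS** (β sub-cell, D1 formalisation swarm, unit `b2b-balaban-beta-d1-formalise-leaf-06`, gen 5; part D2)

HONEST FRAMING (cell charter, verbatim): «discharging `BetaPertH` makes Bałaban's UV stability UNCONDITIONAL — a real constructive-QFT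
result; it is NOT the continuum limit and NOT the Clay problem.»  HONEST DEPENDENCY (verbatim): «continuum YM on T⁴ ⇐ BetaPertH ∧ nine spine
estimates (0/9 proved); BetaPertH ⇐ (D1) ∧ (D4) ∧ CAP+tail; G-an2-4 gates asym, D1 and NE2/3/4.»  [our object] two data definitions (`TBjoint`,
`vh₂SJoint`) and [folklore] wiring BY NAME of part D1 (`TB`, `ward_TB`, its classes), leaf-04's `WardBorderReflectionWallJoint.joint_of_ward_model`,
the row-D1 owner's border machinery (K-L1∕K-L2: `actB`, `stepB`, `Bwall`, `letter_iff_actB`, `locStencil₂_stepB`, `translate_stepB`, `antiTwin_stepB`,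
`stepB_apply_eq_zero`), the hR END `SpineRooted.…_of_letters_antiTwin` (K-G) exactly as K-M2∕C2 use it, part C2's mixed model (`Mjoint`, `ward_Mjoint`)
and leaf-06's hW END `WardLocusParityLevels.…_TW_su_exact₀`.  No statement of Bałaban's papers, no `[cite:]`, no `def … : Prop`; `vh₂SJoint`∕`Mjoint`
are MODELS of typed sockets — NOT Bałaban's second-order averaging jets (an1's `vh₂SAn1`∕`mixFFAt` remain the row's letters for the literal of record
`JsRowD1Pin`; I-d1ref15-1∕17-1 and the leads' (R45) ruling untouched); instantiates NO binder of the β-function wall (0/4: hW, hR, D1Tel, D1Rep).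
NOT D1, NOT `BetaPertH`, NOT continuum, NOT Clay.

WHAT (`d + 1 = 4`, odd `Lc`, centred root `ρ_c`, pins `(cE, cVH) = (Lc⁴, −Lc⁸∕2)`, the END's `γ`∕`hγ`, border weight `cB ≠ 0`):
* §1 slot swap through the border machinery (`canonD_swap`, `Bwall_swap`, `swap_actB`, `swap_stepB`);
* §2 **`TBjoint := stepB 3 (Bwall 3) (… (stepB 0 (Bwall 0) (TB ρ_c Lc (−Lc⁸∕2))))`**: **`TBjoint_solves`** (ALL FOUR hR reflection letters AND the first-slot
  Ward letter — `joint_of_ward_model` BY NAME), `TBjoint_swap`, **`ward_TBjoint''`**, no `ff`∕`mm` block, anti-twin, `LocStencil₂`, block translation;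
* §3 **`vh₂SJoint := cB⁻¹ • TBjoint`**: `borderAt_zero_vh₂SJoint` (K-I's (hBe) at `j = 0` VERBATIM), the END shape lemmas, and **`hBord0_vh₂SJoint`∕
  `hBord0''_vh₂SJoint`** — leaf-06's two level-0 border Ward letters IN THE hW END's OWN SPELLING;
* §4 THE TWO ENDs FOR ONE LITERAL `JsRecWAtOf (… T_W …) (locStencil₂_vh₂SJoint …) (locStencilFM_Mjoint …)`: **`…_jointWard`** (hR, NO letter) and
  **`wardTransversal_…_jointWard`** (hW, NO letter: hBord0∕hBord0″ := §3, hM₂0 := C2's `ward_Mjoint`, `RM₀ := 0`), and `hR_and_hW_jointWard_pinned` —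
  from `Odd Lc`, `2 ≤ N`, `cB ≠ 0` (+ pins) ALONE: the typed hR∕hW socket system (border + mixed, reflection + Ward, both slots, in the END's classes)
  is JOINTLY SATISFIABLE.
Provenance: D1 formalisation swarm, leaf prover 06 (gen 5), 2026-08-20; no existing file touched.
-/

noncomputable section

open Finset
open scoped BigOperators
open Literature.MathematicalPhysics.QuantumFieldTheory
open Literature.MathematicalPhysics.QuantumFieldTheory.Balaban1983to89
open Literature.MathematicalPhysics.QuantumFieldTheory.Balaban1983to89.Beta
open B12Sec2to5 (l1 l1_nonneg)
open ExpKernelCalculus (MKer comp BiLoc shiftK)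
open KernelWard (divV)
open AffineAveraging (Site box toSite)
open AveragingContoursRooted (ctr ctrOff ctrOff_mem_box)
open AveragingHessianKernelsRooted (vhSAt)
open OneStepResolventKernel (Fib)
open OneStepKernelFamily (TbalOf flipK)
open BalabanStepJetsSucc (wE wVH)
open BalabanStepW2 (wV4 wB2)
open BalabanCompositeJets (LocStencil₂)
open SecondOrderResponse (LocStencilFM)
open StepJetData (biLoc_smul)
open PolarizationSign (reflSign AxisReflectionCovariant WardTransversal)
open KernelReflection (refK refK_apply)
open ResolventReflection (bref Φ)
open ColourTrace (Complete TrOrthonormal)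
open WilsonVertex2Sym (wsym22)
open HessKerRate (biLoc_zero)
open Summit.QuantumFields.BalabanUV.Beta.TameKernelCalculus
open Summit.QuantumFields.BalabanUV.Beta.ChartConjugation (conjV conjW)
open Summit.QuantumFields.BalabanUV.Beta.BorderedHessian (diagK conjV_diagK_apply ctGen bhKStepAt bhKStepAt_zero stepScale)
open Summit.QuantumFields.BalabanUV.Beta.AveragingWardRootedStencils (legInd)
open Summit.QuantumFields.BalabanUV.Beta.SpineRooted (SpureRecAt JsRecWAtOf axisReflectionCovariant_flipK_TbalOf_JsRecWAtOf_of_letters_antiTwin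
  lock2_iff)
open Summit.QuantumFields.BalabanUV.Beta.KernelWardLevels (stepScale_zero)
open Summit.QuantumFields.BalabanUV.Beta.SpineRecursiveParity (parityOdd_zero)
open Summit.QuantumFields.BalabanUV.Beta.SecondOrderBorderGauge (actB actB_apply actB_smul letter_iff_actB canonD canonD_apply)
open Summit.QuantumFields.BalabanUV.Beta.SecondOrderBorderGaugeWall (wallD₀ wallD₀_eq)
open Summit.QuantumFields.BalabanUV.Beta.SecondOrderBorderCocycle (stepB antiTwin_stepB stepB_apply_eq_zero bd bdB)
open Summit.QuantumFields.BalabanUV.Beta.SecondOrderBorderClassKit (locStencil₂_stepB translate_stepB)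
open Summit.QuantumFields.BalabanUV.Beta.SecondOrderBorderModel (Bwall Bwall_inl_inl Bwall_inr_inr Bwall_antiTwin)
open Summit.QuantumFields.BalabanUV.Beta.SecondOrderBorderModelClass (locStencil₂_Bwall_common translate_Bwall)
open Summit.QuantumFields.BalabanUV.Beta.WilsonReflectionContact2 (wilsonW₂_bref_ff_canon_bhKAt)
open Summit.QuantumFields.BalabanUV.Beta.ColourBasisSU (suGen suGen_complete suGen_trOrthonormal diagIndex ne_zero_of_two_le)
open Summit.QuantumFields.BalabanUV.Beta.SecondOrderLetterLevels (BorderAt levels border_all_of_prim border_prim_of_zero mixed_all_of_prim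
  locStencilFM_levels parityOdd_levels)
open Summit.QuantumFields.BalabanUV.Beta.WardBorderReflectionWallJoint (joint_of_ward_model)
open Summit.QuantumFields.BalabanUV.Beta.WardMixedJointModel (Mjoint mixedPrim_Mjoint ward_Mjoint locStencilFM_Mjoint Mjoint_translate)
open Summit.QuantumFields.BalabanUV.Beta.WardBorderWardModel (TB TB_swap TB_inl_inl TB_inr_inr TB_antiTwin ward_TB TB_translate)
open Summit.QuantumFields.BalabanUV.Beta.WardBorderWardModelClass (locStencil₂_TB)

namespace Summit.QuantumFields.BalabanUV.Beta.WardBorderJointModel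

/-! ## §1 Slot swap through the border machinery -/
section Swap
variable {d : ℕ} {N : ℕ}
/-- [folklore] The reflection action commutes with the slot swap: a slot-swap symmetric bi-table stays symmetric under `actB`. -/
theorem swap_actB (α : Fin (d + 1)) {F : Fin (d + 1) → (Fin (d + 1) → ℤ) → Fin (d + 1) → (Fin (d + 1) → ℤ) → MKer (d + 1) (Fib d)}
    (hF : ∀ κ u κ' u', F κ' u' κ u = F κ u κ' u') (κ : Fin (d + 1)) (u : Fin (d + 1) → ℤ) (κ' : Fin (d + 1)) (u' : Fin (d + 1) → ℤ) :
    actB N α F κ' u' κ u = actB N α F κ u κ' u' := by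
  show (reflSign α κ' * reflSign α κ) • refK (Φ (d := d) N α) (F κ' (bref α κ' u') κ (bref α κ u)) =
    (reflSign α κ * reflSign α κ') • refK (Φ (d := d) N α) (F κ (bref α κ u) κ' (bref α κ' u'))
  rw [hF, mul_comm]

/-- [folklore] The solution step commutes with the slot swap (symmetric contact, symmetric table ⇒ symmetric step). -/
theorem swap_stepB (α : Fin (d + 1)) {D T : Fin (d + 1) → (Fin (d + 1) → ℤ) → Fin (d + 1) → (Fin (d + 1) → ℤ) → MKer (d + 1) (Fib d)}
    (hD : ∀ κ u κ' u', D κ' u' κ u = D κ u κ' u') (hT : ∀ κ u κ' u', T κ' u' κ u = T κ u κ' u')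
    (κ : Fin (d + 1)) (u : Fin (d + 1) → ℤ) (κ' : Fin (d + 1)) (u' : Fin (d + 1) → ℤ) :
    stepB N α D T κ' u' κ u = stepB N α D T κ u κ' u' := by
  simp only [stepB, Pi.sub_apply, Pi.add_apply, Pi.smul_apply, hD, hT, swap_actB α hT]

end Swap
section Wall
variable {Lc : ℕ} [NeZero Lc]

/-- [folklore] The canonical contact is slot-swap symmetric (gauge form `S′·Δg + S·Δg′ + 𝕄·Δg·Δg′`). -/
theorem canonD_swap {d : ℕ} (𝕄 : MKer (d + 1) (Fib d)) (S : Fin (d + 1) → (Fin (d + 1) → ℤ) → MKer (d + 1) (Fib d))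
    (g : Fin (d + 1) → (Fin (d + 1) → ℤ) → (Fin (d + 1) → ℤ) → Fib d → ℝ)
    (κ : Fin (d + 1)) (u : Fin (d + 1) → ℤ) (κ' : Fin (d + 1)) (u' : Fin (d + 1) → ℤ) :
    canonD 𝕄 S g κ' u' κ u = canonD 𝕄 S g κ u κ' u' := by
  funext x z a b
  rw [canonD_apply, canonD_apply]
  ring

/-- [folklore] **THE BORDER CONTACT IS SLOT-SWAP SYMMETRIC.** -/
theorem Bwall_swap (cΛ : ℝ) (γ : ℕ → ℝ) (α κ : Fin 4) (u : Fin 4 → ℤ) (κ' : Fin 4) (u' : Fin 4 → ℤ) :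
    Bwall Lc cΛ γ α κ' u' κ u = Bwall Lc cΛ γ α κ u κ' u' := by
  show bd (wallD₀ Lc cΛ γ α κ' u' κ u) = bd (wallD₀ Lc cΛ γ α κ u κ' u')
  rw [show wallD₀ Lc cΛ γ α κ' u' κ u = wallD₀ Lc cΛ γ α κ u κ' u' from canonD_swap _ _ _ κ u κ' u']

/-! ## §2 The joint table: the four steps started at the Ward model -/
variable (Lc)
/-- [our object] **THE JOINT hR∕hW BORDER TABLE** (weight-free): leaf-04's four sequential steps over the axes `0, 1, 2, 3` started at the two-slot Ward
model `TB ρ_c Lc (−Lc⁸∕2)` of part D1 (K-L2b's `Twall` is the same recipe started at `0`). -/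
def TBjoint (cΛ : ℝ) (γ : ℕ → ℝ) : Fin 4 → (Fin 4 → ℤ) → Fin 4 → (Fin 4 → ℤ) → MKer 4 (Fib 3) :=
  stepB Lc 3 (Bwall Lc cΛ γ 3) (stepB Lc 2 (Bwall Lc cΛ γ 2) (stepB Lc 1 (Bwall Lc cΛ γ 1) (stepB Lc 0 (Bwall Lc cΛ γ 0)
    (TB (toSite (ctrOff 4 Lc)) Lc (-((Lc : ℝ) ^ 8 / 2))))))
variable {Lc}
/-- [folklore] **THE JOINT TABLE SOLVES ALL FOUR REFLECTION LETTERS AND THE FIRST-SLOT WARD LETTER** (leaf-04's `joint_of_ward_model` fed with part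
D1's `ward_TB`). -/
theorem TBjoint_solves (hLc : Odd Lc) (cΛ : ℝ) (γ : ℕ → ℝ)
    (hγ : ∀ j, γ j = -((Lc : ℝ) ^ 8 / 2) * wVH 3 Lc j / (stepScale 3 Lc j * (Lc : ℝ) ^ 4)) :
    (∀ α : Fin 4, actB Lc α (TBjoint Lc cΛ γ) - TBjoint Lc cΛ γ = Bwall Lc cΛ γ α) ∧
      (∀ (Y : Fin 4 → ℤ) (κ' : Fin 4) (u' : Fin 4 → ℤ),
        (((Lc : ℝ) ^ 4)⁻¹) • ∑ v ∈ box 4 Lc, divV (fun κ u => (1 : ℝ) • TBjoint Lc cΛ γ κ u κ' u') ((Lc : ℤ) • Y + toSite v) =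
          conjV ((-((Lc : ℝ) ^ 8 / 2)) • vhSAt (toSite (ctrOff 4 Lc)) 3 Lc rfl κ' u')
            (diagK ((1 / 2 : ℝ) • ∑ v ∈ box 4 Lc, legInd (toSite (ctrOff 4 Lc)) ((Lc : ℤ) • Y + toSite v)))) :=
  joint_of_ward_model hLc cΛ γ hγ (T := TB (toSite (ctrOff 4 Lc)) Lc (-((Lc : ℝ) ^ 8 / 2))) (ward_TB hLc.pos)

/-- [folklore] **THE JOINT TABLE IS SLOT-SWAP SYMMETRIC** (`TB_swap`, `Bwall_swap`, `swap_stepB` ×4). -/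
theorem TBjoint_swap (cΛ : ℝ) (γ : ℕ → ℝ) (κ : Fin 4) (u : Fin 4 → ℤ) (κ' : Fin 4) (u' : Fin 4 → ℤ) :
    TBjoint Lc cΛ γ κ' u' κ u = TBjoint Lc cΛ γ κ u κ' u' := by
  unfold TBjoint
  exact swap_stepB 3 (Bwall_swap cΛ γ 3) (swap_stepB 2 (Bwall_swap cΛ γ 2) (swap_stepB 1 (Bwall_swap cΛ γ 1)
    (swap_stepB 0 (Bwall_swap cΛ γ 0) (fun κ u κ' u' => TB_swap κ u κ' u')))) κ u κ' u'

/-- [folklore] **THE JOINT TABLE SOLVES THE SECOND-SLOT WARD LETTER** (hBord0″; slot swap). -/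
theorem ward_TBjoint'' (hLc : Odd Lc) (cΛ : ℝ) (γ : ℕ → ℝ)
    (hγ : ∀ j, γ j = -((Lc : ℝ) ^ 8 / 2) * wVH 3 Lc j / (stepScale 3 Lc j * (Lc : ℝ) ^ 4))
    (Y : Fin 4 → ℤ) (κ : Fin 4) (u : Fin 4 → ℤ) :
    (((Lc : ℝ) ^ 4)⁻¹) • ∑ v ∈ box 4 Lc, divV (fun κ' u' => (1 : ℝ) • TBjoint Lc cΛ γ κ u κ' u') ((Lc : ℤ) • Y + toSite v) =
      conjV ((-((Lc : ℝ) ^ 8 / 2)) • vhSAt (toSite (ctrOff 4 Lc)) 3 Lc rfl κ u)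
        (diagK ((1 / 2 : ℝ) • ∑ v ∈ box 4 Lc, legInd (toSite (ctrOff 4 Lc)) ((Lc : ℤ) • Y + toSite v))) := by
  have e : (fun κ' u' => (1 : ℝ) • TBjoint Lc cΛ γ κ u κ' u') = fun κ' u' => (1 : ℝ) • TBjoint Lc cΛ γ κ' u' κ u := by
    funext κ' u'; rw [TBjoint_swap]
  rw [e]
  exact (TBjoint_solves hLc cΛ γ hγ).2 Y κ u

/-- [folklore] The joint table has no field–field block. -/
theorem TBjoint_inl_inl (cΛ : ℝ) (γ : ℕ → ℝ) (κ : Fin 4) (u : Fin 4 → ℤ) (κ' : Fin 4) (u' x z : Fin 4 → ℤ) (β β' : Fin 4) :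
    TBjoint Lc cΛ γ κ u κ' u' x z (Sum.inl β) (Sum.inl β') = 0 := by
  unfold TBjoint
  refine stepB_apply_eq_zero 3 (Bwall_inl_inl cΛ γ 3 · · · · · · β β')
    (stepB_apply_eq_zero 2 (Bwall_inl_inl cΛ γ 2 · · · · · · β β')
      (stepB_apply_eq_zero 1 (Bwall_inl_inl cΛ γ 1 · · · · · · β β')
        (stepB_apply_eq_zero 0 (Bwall_inl_inl cΛ γ 0 · · · · · · β β') (fun κ u κ' u' x z => TB_inl_inl κ u κ' u' x z β β')))) κ u κ' u' x z

/-- [folklore] The joint table has no multiplier–multiplier block. -/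
theorem TBjoint_inr_inr (cΛ : ℝ) (γ : ℕ → ℝ) (κ : Fin 4) (u : Fin 4 → ℤ) (κ' : Fin 4) (u' x z : Fin 4 → ℤ) (m m' : Fin 4) :
    TBjoint Lc cΛ γ κ u κ' u' x z (Sum.inr m) (Sum.inr m') = 0 := by
  unfold TBjoint
  refine stepB_apply_eq_zero 3 (Bwall_inr_inr cΛ γ 3 · · · · · · m m')
    (stepB_apply_eq_zero 2 (Bwall_inr_inr cΛ γ 2 · · · · · · m m')
      (stepB_apply_eq_zero 1 (Bwall_inr_inr cΛ γ 1 · · · · · · m m')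
        (stepB_apply_eq_zero 0 (Bwall_inr_inr cΛ γ 0 · · · · · · m m') (fun κ u κ' u' x z => TB_inr_inr κ u κ' u' x z m m')))) κ u κ' u' x z

/-- [folklore] The joint table is anti-twin on the border. -/
theorem TBjoint_antiTwin (cΛ : ℝ) (γ : ℕ → ℝ) (κ : Fin 4) (u : Fin 4 → ℤ) (κ' : Fin 4) (u' x z : Fin 4 → ℤ) (β m : Fin 4) :
    TBjoint Lc cΛ γ κ u κ' u' z x (Sum.inr m) (Sum.inl β) = -TBjoint Lc cΛ γ κ u κ' u' x z (Sum.inl β) (Sum.inr m) := by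
  unfold TBjoint
  refine antiTwin_stepB 3 (Bwall_antiTwin cΛ γ 3)
    (antiTwin_stepB 2 (Bwall_antiTwin cΛ γ 2)
      (antiTwin_stepB 1 (Bwall_antiTwin cΛ γ 1)
        (antiTwin_stepB 0 (Bwall_antiTwin cΛ γ 0) (fun κ u κ' u' x z β m => TB_antiTwin κ u κ' u' x z β m)))) κ u κ' u' x z β m

/-- [folklore] **THE JOINT TABLE IS A `LocStencil₂` FAMILY** (part D1's class of `TB` and K-L2c's `locStencil₂_stepB` at the common rate). -/
theorem locStencil₂_TBjoint (hLc : Odd Lc) (cΛ : ℝ) (γ : ℕ → ℝ) : ∃ C δ : ℝ, 0 < δ ∧ LocStencil₂ (TBjoint Lc cΛ γ) C δ := by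
  obtain ⟨δ₁, hδ₁, h⟩ := locStencil₂_Bwall_common hLc cΛ γ
  obtain ⟨C0, h0⟩ := h 0
  obtain ⟨C1, h1⟩ := h 1
  obtain ⟨C2, h2⟩ := h 2
  obtain ⟨C3, h3⟩ := h 3
  obtain ⟨CT, δ₂, hδ₂, hT⟩ := locStencil₂_TB hLc.pos (ctrOff_mem_box hLc.pos) (-((Lc : ℝ) ^ 8 / 2))
  set δ := min δ₁ δ₂ with hδ
  have hδ0 : 0 < δ := lt_min hδ₁ hδ₂
  have t1 := locStencil₂_stepB hLc.pos 0 (h0.mono (min_le_left δ₁ δ₂)) (hT.mono (min_le_right δ₁ δ₂)) hδ0.le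
  have t2 := locStencil₂_stepB hLc.pos 1 (h1.mono (min_le_left δ₁ δ₂)) t1 hδ0.le
  have t3 := locStencil₂_stepB hLc.pos 2 (h2.mono (min_le_left δ₁ δ₂)) t2 hδ0.le
  have t4 := locStencil₂_stepB hLc.pos 3 (h3.mono (min_le_left δ₁ δ₂)) t3 hδ0.le
  exact ⟨_, δ, hδ0, t4⟩

/-- [folklore] **THE JOINT TABLE IS BLOCK-TRANSLATION COVARIANT** (`TB_translate`, `translate_Bwall`, `translate_stepB` ×4). -/
theorem TBjoint_translate (hLc : Odd Lc) (cΛ : ℝ) (γ : ℕ → ℝ) (κ : Fin 4) (u : Fin 4 → ℤ) (κ' : Fin 4) (u' t : Fin 4 → ℤ) :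
    TBjoint Lc cΛ γ κ (u + (Lc : ℤ) • t) κ' (u' + (Lc : ℤ) • t) = shiftK (-((Lc : ℤ) • t)) (TBjoint Lc cΛ γ κ u κ' u') := by
  have hB := translate_Bwall hLc cΛ γ
  have t1 := translate_stepB 0 (hB 0) (TB_translate (ρ := toSite (ctrOff 4 Lc)) (c' := -((Lc : ℝ) ^ 8 / 2)) hLc.pos)
  have t2 := translate_stepB 1 (hB 1) t1
  have t3 := translate_stepB 2 (hB 2) t2
  have t4 := translate_stepB 3 (hB 3) t3
  unfold TBjoint
  exact t4 κ u κ' u' t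

/-! ## §3 The model border table `vh₂SJoint` and the END's border hypotheses -/
variable (Lc)
/-- [our object] **THE JOINT MODEL BORDER TABLE** `vh₂SJoint Lc cΛ cB γ := cB⁻¹ • TBjoint Lc cΛ γ` (border weight `cB ≠ 0`). -/
def vh₂SJoint (cΛ cB : ℝ) (γ : ℕ → ℝ) : Fin 4 → (Fin 4 → ℤ) → Fin 4 → (Fin 4 → ℤ) → MKer 4 (Fib 3) :=
  cB⁻¹ • TBjoint Lc cΛ γ
variable {Lc}
/-- [folklore] The weighted joint model is the joint table: `cB • vh₂SJoint κ u κ′ u′ = TBjoint κ u κ′ u′`. -/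
theorem smul_vh₂SJoint (cΛ : ℝ) {cB : ℝ} (hcB : cB ≠ 0) (γ : ℕ → ℝ) (κ : Fin 4) (u : Fin 4 → ℤ) (κ' : Fin 4) (u' : Fin 4 → ℤ) :
    cB • vh₂SJoint Lc cΛ cB γ κ u κ' u' = TBjoint Lc cΛ γ κ u κ' u' := by
  show cB • (cB⁻¹ • TBjoint Lc cΛ γ) κ u κ' u' = TBjoint Lc cΛ γ κ u κ' u'
  rw [Pi.smul_apply, Pi.smul_apply, Pi.smul_apply, Pi.smul_apply, smul_smul, mul_inv_cancel₀ hcB, one_smul]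

/-- [folklore] **THE JOINT MODEL SATISFIES THE hR END's BORDER LETTER AT LEVEL `0`, ALL FOUR AXES** (K-I's (hBe), `j := 0`, VERBATIM via an3's
`BorderAt`; K-L2b's `borderAt_zero_vh₂SModel` with `Twall_solves ↦ TBjoint_solves`). -/
theorem borderAt_zero_vh₂SJoint (hLc : Odd Lc) (cΛ cB : ℝ) (hcB : cB ≠ 0) (γ : ℕ → ℝ)
    (hγ : ∀ j, γ j = -((Lc : ℝ) ^ 8 / 2) * wVH 3 Lc j / (stepScale 3 Lc j * (Lc : ℝ) ^ 4)) :
    BorderAt Lc (toSite (ctrOff 4 Lc)) cΛ cB γ (vh₂SJoint Lc cΛ cB γ) 0 := by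
  intro α κ u κ' u' x z β m
  have hw : wB2 3 Lc 0 = 1 := by simp [BalabanStepW2.wB2]
  have hG : (fun κ u κ' u' => (cB * wB2 3 Lc 0) • vh₂SJoint Lc cΛ cB γ κ u κ' u') = TBjoint Lc cΛ γ := by
    funext κ u κ' u'
    rw [hw, mul_one, smul_vh₂SJoint cΛ hcB γ]
  have hsol := (TBjoint_solves hLc cΛ γ hγ).1 α
  rw [← hG] at hsol
  rw [← wallD₀_eq]
  revert x z
  rw [letter_iff_actB Lc α (fun κ u κ' u' => (cB * wB2 3 Lc 0) • vh₂SJoint Lc cΛ cB γ κ u κ' u') (wallD₀ Lc cΛ γ α)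
    κ u κ' u' (Sum.inl β) (Sum.inr m)]
  intro x z
  have e := congrFun (congrFun (congrFun (congrFun hsol κ) u) κ') u'
  simp only [Pi.sub_apply] at e
  rw [e]
  rfl

/-- [folklore] The joint model has no field–field block (the END's `hB0`). -/
theorem vh₂SJoint_inl_inl (cΛ cB : ℝ) (γ : ℕ → ℝ) (κ : Fin 4) (u : Fin 4 → ℤ) (κ' : Fin 4) (u' x z : Fin 4 → ℤ) (β β' : Fin 4) :
    vh₂SJoint Lc cΛ cB γ κ u κ' u' x z (Sum.inl β) (Sum.inl β') = 0 := by
  simp [vh₂SJoint, TBjoint_inl_inl]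

/-- [folklore] The joint model has no multiplier–multiplier block (the END's `hBmm0`). -/
theorem vh₂SJoint_inr_inr (cΛ cB : ℝ) (γ : ℕ → ℝ) (κ : Fin 4) (u : Fin 4 → ℤ) (κ' : Fin 4) (u' x z : Fin 4 → ℤ) (m m' : Fin 4) :
    vh₂SJoint Lc cΛ cB γ κ u κ' u' x z (Sum.inr m) (Sum.inr m') = 0 := by
  simp [vh₂SJoint, TBjoint_inr_inr]

/-- [folklore] The joint model is anti-twin on the border (the END's `hBat`). -/
theorem vh₂SJoint_antiTwin (cΛ cB : ℝ) (γ : ℕ → ℝ) (κ : Fin 4) (u : Fin 4 → ℤ) (κ' : Fin 4) (u' x z : Fin 4 → ℤ) (β m : Fin 4) :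
    vh₂SJoint Lc cΛ cB γ κ u κ' u' z x (Sum.inr m) (Sum.inl β) = -vh₂SJoint Lc cΛ cB γ κ u κ' u' x z (Sum.inl β) (Sum.inr m) := by
  simp [vh₂SJoint, TBjoint_antiTwin]

/-- [folklore] The joint model is a `LocStencil₂` family (the END's `hB`). -/
theorem locStencil₂_vh₂SJoint (hLc : Odd Lc) (cΛ cB : ℝ) (γ : ℕ → ℝ) : ∃ C δ : ℝ, 0 < δ ∧ LocStencil₂ (vh₂SJoint Lc cΛ cB γ) C δ := by
  obtain ⟨C, δ, hδ, h⟩ := locStencil₂_TBjoint hLc cΛ γ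
  exact ⟨|cB⁻¹| * C, δ, hδ, BalabanStepW2.locStencil₂_smul' cB⁻¹ h⟩

/-- [folklore] The joint model is block-translation covariant (the END's `hBt`). -/
theorem vh₂SJoint_translate (hLc : Odd Lc) (cΛ cB : ℝ) (γ : ℕ → ℝ) (κ : Fin 4) (u : Fin 4 → ℤ) (κ' : Fin 4) (u' t : Fin 4 → ℤ) :
    vh₂SJoint Lc cΛ cB γ κ (u + (Lc : ℤ) • t) κ' (u' + (Lc : ℤ) • t) = shiftK (-((Lc : ℤ) • t)) (vh₂SJoint Lc cΛ cB γ κ u κ' u') := by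
  show cB⁻¹ • TBjoint Lc cΛ γ κ (u + (Lc : ℤ) • t) κ' (u' + (Lc : ℤ) • t) = shiftK (-((Lc : ℤ) • t)) (cB⁻¹ • TBjoint Lc cΛ γ κ u κ' u')
  rw [TBjoint_translate hLc]
  rfl

omit [NeZero Lc] in
/-- [folklore] The hW END's Ward datum in the hR spelling (`−(Lc⁴·½·Lc⁴) = −Lc⁸∕2`, `ctrOff (3+1) = ctrOff 4`, `comp V D − comp D V = conjV V D`). -/
theorem datum_eq (Y : Fin (3 + 1) → ℤ) (κ' : Fin (3 + 1)) (u' : Fin (3 + 1) → ℤ) :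
    comp ((-((Lc : ℝ) ^ (3 + 1) * (1 / 2) * (Lc : ℝ) ^ (3 + 1))) • vhSAt (toSite (ctrOff (3 + 1) Lc)) 3 Lc rfl κ' u')
        (diagK (((1 : ℝ) / 2) • ∑ v ∈ box (3 + 1) Lc, legInd (toSite (ctrOff (3 + 1) Lc)) ((Lc : ℤ) • Y + toSite v))) -
      comp (diagK (((1 : ℝ) / 2) • ∑ v ∈ box (3 + 1) Lc, legInd (toSite (ctrOff (3 + 1) Lc)) ((Lc : ℤ) • Y + toSite v)))
        ((-((Lc : ℝ) ^ (3 + 1) * (1 / 2) * (Lc : ℝ) ^ (3 + 1))) • vhSAt (toSite (ctrOff (3 + 1) Lc)) 3 Lc rfl κ' u') =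
    conjV ((-((Lc : ℝ) ^ 8 / 2)) • vhSAt (toSite (ctrOff 4 Lc)) 3 Lc rfl κ' u')
        (diagK ((1 / 2 : ℝ) • ∑ v ∈ box 4 Lc, legInd (toSite (ctrOff 4 Lc)) ((Lc : ℤ) • Y + toSite v))) := by
  have hc : (-((Lc : ℝ) ^ (3 + 1) * (1 / 2) * (Lc : ℝ) ^ (3 + 1))) = -((Lc : ℝ) ^ 8 / 2) := by ring
  rw [hc]
  rfl

/-- [folklore] **hBord0 FOR THE JOINT MODEL, IN THE hW END's OWN SPELLING** (`stepScale 0 = 1`, `cB • vh₂SJoint = TBjoint`). -/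
theorem hBord0_vh₂SJoint (hLc : Odd Lc) (cΛ cB : ℝ) (hcB : cB ≠ 0) (γ : ℕ → ℝ)
    (hγ : ∀ j, γ j = -((Lc : ℝ) ^ 8 / 2) * wVH 3 Lc j / (stepScale 3 Lc j * (Lc : ℝ) ^ 4))
    (Y : Fin (3 + 1) → ℤ) (κ' : Fin (3 + 1)) (u' : Fin (3 + 1) → ℤ) :
    (stepScale 3 Lc 0 * (Lc : ℝ) ^ (3 + 1))⁻¹ • ∑ v ∈ box (3 + 1) Lc,
        divV (fun κ u => cB • vh₂SJoint Lc cΛ cB γ κ u κ' u') ((Lc : ℤ) • Y + toSite v) =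
      comp ((-((Lc : ℝ) ^ (3 + 1) * (1 / 2) * (Lc : ℝ) ^ (3 + 1))) • vhSAt (toSite (ctrOff (3 + 1) Lc)) 3 Lc rfl κ' u')
          (diagK (((1 : ℝ) / 2) • ∑ v ∈ box (3 + 1) Lc, legInd (toSite (ctrOff (3 + 1) Lc)) ((Lc : ℤ) • Y + toSite v))) -
        comp (diagK (((1 : ℝ) / 2) • ∑ v ∈ box (3 + 1) Lc, legInd (toSite (ctrOff (3 + 1) Lc)) ((Lc : ℤ) • Y + toSite v)))
          ((-((Lc : ℝ) ^ (3 + 1) * (1 / 2) * (Lc : ℝ) ^ (3 + 1))) • vhSAt (toSite (ctrOff (3 + 1) Lc)) 3 Lc rfl κ' u') := by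
  have e : (fun κ u => cB • vh₂SJoint Lc cΛ cB γ κ u κ' u') = fun κ u => (1 : ℝ) • TBjoint Lc cΛ γ κ u κ' u' := by
    funext κ u; rw [smul_vh₂SJoint cΛ hcB γ, one_smul]
  rw [e, datum_eq, stepScale_zero, one_mul]
  exact (TBjoint_solves hLc cΛ γ hγ).2 Y κ' u'

/-- [folklore] **hBord0″ FOR THE JOINT MODEL, IN THE hW END's OWN SPELLING.** -/
theorem hBord0''_vh₂SJoint (hLc : Odd Lc) (cΛ cB : ℝ) (hcB : cB ≠ 0) (γ : ℕ → ℝ)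
    (hγ : ∀ j, γ j = -((Lc : ℝ) ^ 8 / 2) * wVH 3 Lc j / (stepScale 3 Lc j * (Lc : ℝ) ^ 4))
    (Y : Fin (3 + 1) → ℤ) (κ : Fin (3 + 1)) (u : Fin (3 + 1) → ℤ) :
    (stepScale 3 Lc 0 * (Lc : ℝ) ^ (3 + 1))⁻¹ • ∑ v ∈ box (3 + 1) Lc,
        divV (fun κ' u' => cB • vh₂SJoint Lc cΛ cB γ κ u κ' u') ((Lc : ℤ) • Y + toSite v) =
      comp ((-((Lc : ℝ) ^ (3 + 1) * (1 / 2) * (Lc : ℝ) ^ (3 + 1))) • vhSAt (toSite (ctrOff (3 + 1) Lc)) 3 Lc rfl κ u)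
          (diagK (((1 : ℝ) / 2) • ∑ v ∈ box (3 + 1) Lc, legInd (toSite (ctrOff (3 + 1) Lc)) ((Lc : ℤ) • Y + toSite v))) -
        comp (diagK (((1 : ℝ) / 2) • ∑ v ∈ box (3 + 1) Lc, legInd (toSite (ctrOff (3 + 1) Lc)) ((Lc : ℤ) • Y + toSite v)))
          ((-((Lc : ℝ) ^ (3 + 1) * (1 / 2) * (Lc : ℝ) ^ (3 + 1))) • vhSAt (toSite (ctrOff (3 + 1) Lc)) 3 Lc rfl κ u) := by
  have e : (fun κ' u' => cB • vh₂SJoint Lc cΛ cB γ κ u κ' u') = fun κ' u' => (1 : ℝ) • TBjoint Lc cΛ γ κ u κ' u' := by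
    funext κ' u'; rw [smul_vh₂SJoint cΛ hcB γ, one_smul]
  rw [e, datum_eq, stepScale_zero, one_mul]
  exact ward_TBjoint'' hLc cΛ γ hγ Y κ u

end Wall
/-! ## §4 The two ENDs for ONE literal: border table `vh₂SJoint`, mixed table `Mjoint` — NO LETTER HYPOTHESIS -/

section Ends
variable {Lc : ℕ} [NeZero Lc]

/-- [folklore] **hR FOR THE JOINTLY-MODELLED WALL LITERAL, NO LETTER HYPOTHESIS** (general colour basis; K-M2's `…_models` ∕ C2's `…_jointModels`
with `vh₂SModel ↦ vh₂SJoint`): the recursive wall at `T := (8N²)⁻¹•wsym22 N`, `vh₂S := vh₂SJoint`, `mixFF := Mjoint` is axis-reflection covariant at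
every level, from odd `Lc`, the colour data, `cB ≠ 0`, `γ`∕`hγ` and lock2 ONLY. -/
theorem axisReflectionCovariant_flipK_TbalOf_JsRecWAtOf_jointWard (hLc : Odd Lc) {N : ℕ} {C : Type*} [Fintype C] [DecidableEq C]
    {τ : C → Matrix (Fin N) (Fin N) ℂ} (hτ : Complete τ) (ho : TrOrthonormal τ) (hN : N ≠ 0) (c : C) (cΛ cE₂ cB : ℝ) (hcB : cB ≠ 0)
    (γ : ℕ → ℝ) (hγ : ∀ j, γ j = -((Lc : ℝ) ^ 8 / 2) * wVH 3 Lc j / (stepScale 3 Lc j * (Lc : ℝ) ^ 4))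
    (hlock2 : ∀ j, cE₂ * wV4 3 Lc (j + 1) * wVH 3 Lc (j + 1) = ((Lc : ℝ) ^ 4 * wE 3 Lc (j + 1)) ^ 2) :
    ∀ j : ℕ, AxisReflectionCovariant
      (flipK (TbalOf Lc (JsRecWAtOf (d := 3) hLc.pos (ctrOff_mem_box hLc.pos) ((Lc : ℝ) ^ 4) (-((Lc : ℝ) ^ 8 / 2)) cΛ cE₂ cB
        ((8 * (N : ℝ) ^ 2)⁻¹ • wsym22 N) (locStencil₂_vh₂SJoint hLc cΛ cB γ) (locStencilFM_Mjoint hLc cΛ)) j)) :=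
  axisReflectionCovariant_flipK_TbalOf_JsRecWAtOf_of_letters_antiTwin hLc cΛ cE₂ cB ((8 * (N : ℝ) ^ 2)⁻¹ • wsym22 N)
    (locStencil₂_vh₂SJoint hLc cΛ cB γ) (vh₂SJoint_inl_inl cΛ cB γ) (locStencilFM_Mjoint hLc cΛ) γ hγ hlock2
    (levels Lc (fun _ _ _ _ _ => 0)) (fun _ _ _ _ _ => 0)
    (fun α κ u κ' u' x z β β' => by
      simpa only [Pi.zero_apply, add_zero, bhKStepAt_zero] using
        wilsonW₂_bref_ff_canon_bhKAt (d := 3) hτ ho hN c (toSite (ctrOff 4 Lc)) Lc Lc α κ κ' u u' x z β β')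
    (fun _ _ _ _ _ _ _ _ _ => rfl) (fun _ _ _ _ _ _ _ _ _ => rfl)
    (fun _ => ⟨0, 1, one_pos, fun κ u κ' u' => by simpa using (biLoc_zero u u (1 : ℝ) : BiLoc (0 : MKer 4 (Fib 3)) u u 0 1)⟩)
    (fun _ _ _ _ _ => parityOdd_zero)
    (mixed_all_of_prim (toSite (ctrOff 4 Lc)) cΛ hγ (mixedPrim_Mjoint hLc cΛ))
    (locStencilFM_levels fun _ => ⟨0, 1, one_pos, fun κ u ρ w => by simpa using (biLoc_zero u u (1 : ℝ) : BiLoc (0 : MKer 4 (Fib 3)) u u 0 1)⟩)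
    (parityOdd_levels fun _ _ _ _ _ => parityOdd_zero)
    (vh₂SJoint_antiTwin cΛ cB γ) (vh₂SJoint_inr_inr cΛ cB γ)
    (border_all_of_prim (toSite (ctrOff 4 Lc)) cΛ cB hγ
      (border_prim_of_zero (toSite (ctrOff 4 Lc)) cΛ cB hγ (borderAt_zero_vh₂SJoint hLc cΛ cB hcB γ hγ)))
    (vh₂SJoint_translate hLc cΛ cB γ) (Mjoint_translate hLc cΛ)

/-- [folklore] **THE `SU(N)` INSTANCE, `N ≥ 2`** of the hR END for the jointly-modelled literal. -/
theorem axisReflectionCovariant_flipK_TbalOf_JsRecWAtOf_jointWard_suN (hLc : Odd Lc) {N : ℕ} (hN : 2 ≤ N) (cΛ cE₂ cB : ℝ) (hcB : cB ≠ 0)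
    (γ : ℕ → ℝ) (hγ : ∀ j, γ j = -((Lc : ℝ) ^ 8 / 2) * wVH 3 Lc j / (stepScale 3 Lc j * (Lc : ℝ) ^ 4))
    (hlock2 : ∀ j, cE₂ * wV4 3 Lc (j + 1) * wVH 3 Lc (j + 1) = ((Lc : ℝ) ^ 4 * wE 3 Lc (j + 1)) ^ 2) :
    ∀ j : ℕ, AxisReflectionCovariant
      (flipK (TbalOf Lc (JsRecWAtOf (d := 3) hLc.pos (ctrOff_mem_box hLc.pos) ((Lc : ℝ) ^ 4) (-((Lc : ℝ) ^ 8 / 2)) cΛ cE₂ cB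
        ((8 * (N : ℝ) ^ 2)⁻¹ • wsym22 N) (locStencil₂_vh₂SJoint hLc cΛ cB γ) (locStencilFM_Mjoint hLc cΛ)) j)) :=
  axisReflectionCovariant_flipK_TbalOf_JsRecWAtOf_jointWard hLc (suGen_complete (ne_zero_of_two_le hN)) (suGen_trOrthonormal N)
    (ne_zero_of_two_le hN) (diagIndex hN) cΛ cE₂ cB hcB γ hγ hlock2

/-- [folklore] **hW FOR THE SAME LITERAL, NO LETTER HYPOTHESIS** (every `SU(N)`, `N ≥ 2`, odd `Lc`, `cB ≠ 0`, pin `cE₂ = Lc^{2(3+1)}`, the END's `γ`∕`hγ`):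
leaf-06's `…_TW_su_exact₀` at `vh₂S := vh₂SJoint`, `mixFF := Mjoint`, ALL THREE level-0 Ward letters DISCHARGED (hBord0∕hBord0″ by §3, hM₂0 by C2's
`ward_Mjoint`, `RM₀ := 0`), `hB`∕`hBt`∕`hmix`∕`hmixt` by the model lemmas; hW spelling `cVH = −(Lc⁴·½·Lc⁴)`, root `ctrOff (3+1) Lc` (same terms). -/
theorem wardTransversal_flipK_TbalOf_JsRecWAtOf_jointWard (hLc : Odd Lc) {N : ℕ} (hN : 2 ≤ N) (cΛ cB : ℝ) (hcB : cB ≠ 0) {cE₂ : ℝ}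
    (hcE₂ : cE₂ = (Lc : ℝ) ^ (2 * (3 + 1))) (γ : ℕ → ℝ)
    (hγ : ∀ j, γ j = -((Lc : ℝ) ^ 8 / 2) * wVH 3 Lc j / (stepScale 3 Lc j * (Lc : ℝ) ^ 4)) :
    ∀ j : ℕ, WardTransversal (flipK (TbalOf Lc
      (JsRecWAtOf (d := 3) hLc.pos (ctrOff_mem_box hLc.pos) ((Lc : ℝ) ^ (3 + 1)) (-((Lc : ℝ) ^ (3 + 1) * (1 / 2) * (Lc : ℝ) ^ (3 + 1))) cΛ cE₂ cB
        ((8 * (N : ℝ) ^ 2)⁻¹ • wsym22 N) (locStencil₂_vh₂SJoint hLc cΛ cB γ) (locStencilFM_Mjoint hLc cΛ)) j)) :=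
  WardLocusParityLevels.wardTransversal_flipK_TbalOf_JsRecWAtOf_TW_su_exact₀ hN hLc.pos (ctrOff_mem_box hLc.pos) cΛ cB hcE₂
    (locStencil₂_vh₂SJoint hLc cΛ cB γ) (vh₂SJoint_translate hLc cΛ cB γ) (locStencilFM_Mjoint hLc cΛ) (Mjoint_translate hLc cΛ)
    (RM₀ := fun _ _ _ => 0) ⟨0, 1, one_pos, fun y ρ' w => by simpa using (biLoc_zero ((Lc : ℤ) • w) ((Lc : ℤ) • w) (1 : ℝ) :
      BiLoc (0 : MKer (3 + 1) (Fib 3)) ((Lc : ℤ) • w) ((Lc : ℤ) • w) 0 1)⟩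
    (fun _ _ _ => parityOdd_zero) (hBord0_vh₂SJoint hLc cΛ cB hcB γ hγ) (hBord0''_vh₂SJoint hLc cΛ cB hcB γ hγ)
    (fun y ρ' w => by rw [add_zero]; exact ward_Mjoint hLc y ρ' w)

/-- [folklore] **BOTH BINDERS FOR ONE LITERAL, PINNED** (`γ :=` the END's formula by `rfl`, `cE₂ := Lc⁸`): for odd `Lc`, `2 ≤ N`, any `cΛ`, any `cB ≠ 0`,
the fully-modelled `SU(N)` wall literal is axis-reflection covariant (hR) AND Ward transversal (hW) at every level — NO further hypothesis.
(hR spelling `(Lc⁴, −Lc⁸∕2, ctrOff 4)`; hW spelling `(Lc^{3+1}, −(Lc^{3+1}·½·Lc^{3+1}), ctrOff (3+1))` — the same terms up to `norm_num`.) -/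
theorem hR_and_hW_jointWard_pinned (hLc : Odd Lc) {N : ℕ} (hN : 2 ≤ N) (cΛ cB : ℝ) (hcB : cB ≠ 0) :
    (∀ j : ℕ, AxisReflectionCovariant
      (flipK (TbalOf Lc (JsRecWAtOf (d := 3) hLc.pos (ctrOff_mem_box hLc.pos) ((Lc : ℝ) ^ 4) (-((Lc : ℝ) ^ 8 / 2)) cΛ ((Lc : ℝ) ^ 8) cB
        ((8 * (N : ℝ) ^ 2)⁻¹ • wsym22 N)
        (locStencil₂_vh₂SJoint hLc cΛ cB (fun j => -((Lc : ℝ) ^ 8 / 2) * wVH 3 Lc j / (stepScale 3 Lc j * (Lc : ℝ) ^ 4)))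
        (locStencilFM_Mjoint hLc cΛ)) j))) ∧
    (∀ j : ℕ, WardTransversal (flipK (TbalOf Lc
      (JsRecWAtOf (d := 3) hLc.pos (ctrOff_mem_box hLc.pos) ((Lc : ℝ) ^ (3 + 1)) (-((Lc : ℝ) ^ (3 + 1) * (1 / 2) * (Lc : ℝ) ^ (3 + 1))) cΛ
        ((Lc : ℝ) ^ 8) cB ((8 * (N : ℝ) ^ 2)⁻¹ • wsym22 N)
        (locStencil₂_vh₂SJoint hLc cΛ cB (fun j => -((Lc : ℝ) ^ 8 / 2) * wVH 3 Lc j / (stepScale 3 Lc j * (Lc : ℝ) ^ 4)))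
        (locStencilFM_Mjoint hLc cΛ)) j))) :=
  ⟨axisReflectionCovariant_flipK_TbalOf_JsRecWAtOf_jointWard_suN hLc hN cΛ ((Lc : ℝ) ^ 8) cB hcB
      (fun j => -((Lc : ℝ) ^ 8 / 2) * wVH 3 Lc j / (stepScale 3 Lc j * (Lc : ℝ) ^ 4)) (fun _ => rfl) (fun j => (lock2_iff ((Lc : ℝ) ^ 8) j).2 rfl),
    wardTransversal_flipK_TbalOf_JsRecWAtOf_jointWard hLc hN cΛ cB hcB (by norm_num)
      (fun j => -((Lc : ℝ) ^ 8 / 2) * wVH 3 Lc j / (stepScale 3 Lc j * (Lc : ℝ) ^ 4)) (fun _ => rfl)⟩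

end Ends

end Summit.QuantumFields.BalabanUV.Beta.WardBorderJointModel

end
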